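import Summits.HodgeConjecture.HodgeConjecture.Theorems.TropicalKugaSatakeCayleyCayleyHodgeRankTwoDerivationCalculus
import Summits.HodgeConjecture.HodgeConjecture.Theorems.TropicalKugaSatakeCayleyCayleyHodgeRankTwoPeriodStructure
import Mathlib

/-!
# Route `TropicalKugaSatakeCayley`, support S5 `CayleyHodgeRankTwo` (stmt-HodgeConjecture-18573) — part A3:
# THE FLATNESS CRITERION — forms killed by ten cusp derivations are of type `(p,p)` on every member

Let `c` be a constant alternating `k`-form on `Λ_ℝ = ℝ⁸_x ⊕ ℝ⁸_y` (`k = p + p`). If the slotwise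
derivations of `c` along the ten CUSP OPERATORS vanish —
the raising operators `Nᵢ(x, y) = (Bᵢ y, 0)` (`Bᵢ = ksForm i`) and the lowering operators
`N'ⱼ(x, y) = (0, Cⱼ x)` (`Cⱼ = B₁⁻¹ Bⱼ B₁⁻¹`, `B₁⁻¹ = diag(2,4,4,8,4,8,8,16)⁻¹`), `i, j < 5` —
then for EVERY `z` of the tube domain (`Im z ∈ ksPosCone`) and EVERY Kuga–Satake period map `Φ` of `z`
the form `c ∘ Φ⁻¹` is of type `(p,p)` on `ℂ⁸` (`ComplexTorus.IsConstOfType p p`), i.e. `c` is a Hodge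
form on every member `ℂ⁸/(ℤ⁸ ⊕ τ(z)ℤ⁸)` of the family (`tkc_isConstOfType_of_cusp_derivations`).

Proof (parts A1, A2): the complex structure of the member is `J_z = A_R⁻¹ J_(iS) A_R`,
`A_R(x, y) = (x + Ry, y)`, `J_(iS) = −N_S + N'_(S⁻¹)` (`tkc_J_apply`), with `N_S = Σ tᵢ Nᵢ` and
`S⁻¹ = Σ uⱼ Cⱼ` (the Clifford inverse formula `tkc_ksMatrix_inv_mem_span`); so `D_(N_R) c = 0`
(linearity), `c` is `A_R`-invariant (unipotent integration, `N_R² = 0`), `D_(J_(iS)) c = 0`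
(`tkc_deriv_J0_zero`), hence `D_(J_z) c = 0` (conjugation), which integrates along `J_z` (`J_z² = −1`)
to `c(e^(θJ_z) w) = c(w)` — the type-`(p,p)` condition read through `Φ`.

Use (part B, to come): the flat Hodge classes of the family are found by EXACT LINEAR ALGEBRA at the
cusp — the common kernel of the ten derivations on the `(2,2)`-forms has dimension `6 = 1 + 5`
(theta + Cayley; van Geemen–Verra Cor. 6.5), and two independent explicit integral `(6,6)`-forms in the
kernel give S5. Theorems only: no definition, no named fact, no sorry.

## References

* [vanGeemenVerra2003QuaternionicPryms] B. van Geemen, A. Verra, Quaternionic Pryms and Hodge classes,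
  Topology 42 (2003), §6.1, Cor. 6.5, Lemma 6.8.
* [LangeBirkenhake1992] H. Lange, Ch. Birkenhake, Complex Abelian Varieties (1992), §1.1.5, §8.1.
* [FarautKoranyi1994] J. Faraut, A. Korányi, Analysis on Symmetric Cones (1994), Ch. X (tube domains
  over symmetric cones; the affine group generated by translations and the structure group).
-/

noncomputable section

set_option linter.dupNamespace false

namespace Summit.HodgeConjecture.HodgeConjecture.Theorems

open Literature.AlgebraicGeometry.Tropical Literature.AlgebraicGeometry.Tropical.TropicalTorus
open Literature.Geometry.Kaehler
open scoped Matrix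

/-! ### §3 The flatness criterion -/

section Criterion

/-- `B_r y = Σ rᵢ (Bᵢ y)`. [folklore] -/
theorem tkc_ksMatrix_mulVec (r : Fin 5 → ℝ) (y : Fin 8 → ℝ) :
    ksMatrix r *ᵥ y = ∑ i, r i • ((ksForm i).map (Int.cast : ℤ → ℝ) *ᵥ y) := by
  rw [ksMatrix, Matrix.sum_mulVec]
  exact Finset.sum_congr rfl fun i _ => Matrix.smul_mulVec _ _ _

/-- The raising operator of `R = B_r` is the combination `Σ rᵢ Nᵢ` of the cusp raising operators
`Nᵢ(x, y) = (Bᵢ y, 0)`. [folklore] -/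
theorem tkc_NR_eq (r : Fin 5 → ℝ) (w : Fin 8 ⊕ Fin 8 → ℝ) :
    (Sum.elim (ksMatrix r *ᵥ fun j => w (Sum.inr j)) 0 : Fin 8 ⊕ Fin 8 → ℝ) =
      ∑ i, r i • (Sum.elim ((ksForm i).map (Int.cast : ℤ → ℝ) *ᵥ fun j => w (Sum.inr j)) 0 :
        Fin 8 ⊕ Fin 8 → ℝ) := by
  rw [tkc_ksMatrix_mulVec]
  funext s
  rcases s with a | a <;> simp [Finset.sum_apply]

/-- The lowering operator of a combination `Σ uⱼ Cⱼ` is `Σ uⱼ N'ⱼ`, `N'ⱼ(x, y) = (0, Cⱼ x)`. [folklore] -/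
theorem tkc_N'_eq (u : Fin 5 → ℝ) (w : Fin 8 ⊕ Fin 8 → ℝ) :
    (Sum.elim 0 ((∑ j, u j • ((Matrix.diagonal fun i : Fin 8 => ((((![2, 4, 4, 8, 4, 8, 8, 16] : Fin 8 → ℤ) i : ℝ))⁻¹)) * (ksForm j).map (Int.cast : ℤ → ℝ) * (Matrix.diagonal fun i : Fin 8 => ((((![2, 4, 4, 8, 4, 8, 8, 16] : Fin 8 → ℤ) i : ℝ))⁻¹)))) *ᵥ
        fun i => w (Sum.inl i)) : Fin 8 ⊕ Fin 8 → ℝ) =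
      ∑ j, u j • (Sum.elim 0 (((Matrix.diagonal fun i : Fin 8 => ((((![2, 4, 4, 8, 4, 8, 8, 16] : Fin 8 → ℤ) i : ℝ))⁻¹)) * (ksForm j).map (Int.cast : ℤ → ℝ) * (Matrix.diagonal fun i : Fin 8 => ((((![2, 4, 4, 8, 4, 8, 8, 16] : Fin 8 → ℤ) i : ℝ))⁻¹))) *ᵥ
        fun i => w (Sum.inl i)) : Fin 8 ⊕ Fin 8 → ℝ) := by
  rw [Matrix.sum_mulVec]
  funext s
  rcases s with a | a <;> simp [Finset.sum_apply, Matrix.smul_mulVec]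

variable {k : ℕ}

/-- **Raising operators of the whole family kill a cusp-flat form**: if `D_(Nᵢ) c = 0` for the five
cusp raising operators then `D_(N_R) c = 0` for every `R = B_r`. [folklore] -/
theorem tkc_deriv_NR_zero (c : (Fin 8 ⊕ Fin 8 → ℝ) [⋀^Fin k]→L[ℝ] ℂ)
    (hN : ∀ (i : Fin 5) (w : Fin k → (Fin 8 ⊕ Fin 8 → ℝ)), ∑ m, c (Function.update w m
      (Sum.elim ((ksForm i).map (Int.cast : ℤ → ℝ) *ᵥ fun j => w m (Sum.inr j)) 0)) = 0)
    (r : Fin 5 → ℝ) (w : Fin k → (Fin 8 ⊕ Fin 8 → ℝ)) :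
    ∑ m, c (Function.update w m (Sum.elim (ksMatrix r *ᵥ fun j => w m (Sum.inr j)) 0)) = 0 := by
  have h := tkc_deriv_linear_sum Finset.univ c
    (fun i v => (Sum.elim ((ksForm i).map (Int.cast : ℤ → ℝ) *ᵥ fun j => v (Sum.inr j)) 0 : (Fin 8 ⊕ Fin 8 → ℝ)))
    r (fun i _ w' => hN i w') w
  simp only [← tkc_NR_eq] at h
  exact h

/-- **Lowering operators in the span of the `Cⱼ` kill a cusp-flat form.** [folklore] -/
theorem tkc_deriv_N'_zero (c : (Fin 8 ⊕ Fin 8 → ℝ) [⋀^Fin k]→L[ℝ] ℂ)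
    (hN' : ∀ (j : Fin 5) (w : Fin k → (Fin 8 ⊕ Fin 8 → ℝ)), ∑ m, c (Function.update w m
      (Sum.elim 0 (((Matrix.diagonal fun i : Fin 8 => ((((![2, 4, 4, 8, 4, 8, 8, 16] : Fin 8 → ℤ) i : ℝ))⁻¹)) * (ksForm j).map (Int.cast : ℤ → ℝ) * (Matrix.diagonal fun i : Fin 8 => ((((![2, 4, 4, 8, 4, 8, 8, 16] : Fin 8 → ℤ) i : ℝ))⁻¹))) *ᵥ fun i => w m (Sum.inl i)))) = 0)
    (u : Fin 5 → ℝ) (w : Fin k → (Fin 8 ⊕ Fin 8 → ℝ)) :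
    ∑ m, c (Function.update w m (Sum.elim 0
      ((∑ j, u j • ((Matrix.diagonal fun i : Fin 8 => ((((![2, 4, 4, 8, 4, 8, 8, 16] : Fin 8 → ℤ) i : ℝ))⁻¹)) * (ksForm j).map (Int.cast : ℤ → ℝ) * (Matrix.diagonal fun i : Fin 8 => ((((![2, 4, 4, 8, 4, 8, 8, 16] : Fin 8 → ℤ) i : ℝ))⁻¹)))) *ᵥ fun i => w m (Sum.inl i)))) = 0 := by
  have h := tkc_deriv_linear_sum Finset.univ c
    (fun j v => (Sum.elim 0 (((Matrix.diagonal fun i : Fin 8 => ((((![2, 4, 4, 8, 4, 8, 8, 16] : Fin 8 → ℤ) i : ℝ))⁻¹)) * (ksForm j).map (Int.cast : ℤ → ℝ) * (Matrix.diagonal fun i : Fin 8 => ((((![2, 4, 4, 8, 4, 8, 8, 16] : Fin 8 → ℤ) i : ℝ))⁻¹))) *ᵥ fun i => v (Sum.inl i)) : (Fin 8 ⊕ Fin 8 → ℝ)))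
    u (fun j _ w' => hN' j w') w
  simp only [← tkc_N'_eq] at h
  exact h

/-- **Invariance under the unipotent `A_R(x, y) = (x + Ry, y)`** of a cusp-flat form (integration of
`D_(N_R) c = 0`, `N_R² = 0`). [folklore] -/
theorem tkc_AR_invariant (c : (Fin 8 ⊕ Fin 8 → ℝ) [⋀^Fin k]→L[ℝ] ℂ)
    (hN : ∀ (i : Fin 5) (w : Fin k → (Fin 8 ⊕ Fin 8 → ℝ)), ∑ m, c (Function.update w m
      (Sum.elim ((ksForm i).map (Int.cast : ℤ → ℝ) *ᵥ fun j => w m (Sum.inr j)) 0)) = 0)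
    (r : Fin 5 → ℝ) (u : Fin k → (Fin 8 ⊕ Fin 8 → ℝ)) :
    c (fun m => (Sum.elim ((fun i => u m (Sum.inl i)) + ksMatrix r *ᵥ fun j => u m (Sum.inr j))
      (fun j => u m (Sum.inr j)) : (Fin 8 ⊕ Fin 8 → ℝ))) = c u := by
  -- the raising operator as a continuous linear map
  let N : (Fin 8 ⊕ Fin 8 → ℝ) →ₗ[ℝ] (Fin 8 ⊕ Fin 8 → ℝ) :=
    { toFun := fun w => Sum.elim (ksMatrix r *ᵥ fun j => w (Sum.inr j)) 0
      map_add' := fun w w' => by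
        have h : (fun j => (w + w') (Sum.inr j)) = (fun j => w (Sum.inr j)) + fun j => w' (Sum.inr j) := rfl
        rw [h, Matrix.mulVec_add]
        funext s; rcases s with i | i <;> simp
      map_smul' := fun a w => by
        have h : (fun j => (a • w) (Sum.inr j)) = a • fun j => w (Sum.inr j) := rfl
        rw [h, Matrix.mulVec_smul]
        funext s; rcases s with i | i <;> simp }
  let Nc : (Fin 8 ⊕ Fin 8 → ℝ) →L[ℝ] (Fin 8 ⊕ Fin 8 → ℝ) := LinearMap.toContinuousLinearMap N
  have hNc : ∀ w, Nc w = Sum.elim (ksMatrix r *ᵥ fun j => w (Sum.inr j)) 0 := fun w => rfl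
  have hN2 : ∀ v, Nc (Nc v) = 0 := by
    intro v
    rw [hNc, hNc]
    have h0 : (fun j => ((ksMatrix r *ᵥ fun j => v (Sum.inr j)) ⊕ᵥ (0 : Fin 8 → ℝ)) (Sum.inr j)) = 0 := by
      funext j; rfl
    rw [h0, Matrix.mulVec_zero]
    funext s; rcases s with i | i <;> rfl
  have hD : ∀ w : Fin k → (Fin 8 ⊕ Fin 8 → ℝ), ∑ m, c (Function.update w m (Nc (w m))) = 0 := by
    intro w
    simp only [hNc]
    exact tkc_deriv_NR_zero c hN r w
  have h := tkc_unipotent_of_deriv_zero c Nc hN2 hD u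
  have hA : ∀ m, u m + Nc (u m) = (Sum.elim ((fun i => u m (Sum.inl i)) + ksMatrix r *ᵥ fun j => u m (Sum.inr j))
      (fun j => u m (Sum.inr j)) : (Fin 8 ⊕ Fin 8 → ℝ)) := by
    intro m
    rw [hNc]
    funext s; rcases s with i | i <;> simp
  simp only [hA] at h
  exact h

end Criterion

section Main

variable {k : ℕ}

/-- **The cusp complex structure `J_(iS) = −N_S + N'_(S⁻¹)` kills a cusp-flat form** (`N_S = Σ tᵢ Nᵢ`
and, by the inverse formula, `N'_(S⁻¹) = Σ uⱼ N'ⱼ`). [folklore] -/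
theorem tkc_deriv_J0_zero (c : (Fin 8 ⊕ Fin 8 → ℝ) [⋀^Fin k]→L[ℝ] ℂ)
    (hN : ∀ (i : Fin 5) (w : Fin k → (Fin 8 ⊕ Fin 8 → ℝ)), ∑ m, c (Function.update w m
      (Sum.elim ((ksForm i).map (Int.cast : ℤ → ℝ) *ᵥ fun j => w m (Sum.inr j)) 0)) = 0)
    (hN' : ∀ (j : Fin 5) (w : Fin k → (Fin 8 ⊕ Fin 8 → ℝ)), ∑ m, c (Function.update w m
      (Sum.elim 0 (((Matrix.diagonal fun i : Fin 8 => ((((![2, 4, 4, 8, 4, 8, 8, 16] : Fin 8 → ℤ) i : ℝ))⁻¹)) * (ksForm j).map (Int.cast : ℤ → ℝ) * (Matrix.diagonal fun i : Fin 8 => ((((![2, 4, 4, 8, 4, 8, 8, 16] : Fin 8 → ℤ) i : ℝ))⁻¹))) *ᵥ fun i => w m (Sum.inl i)))) = 0)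
    {z : Fin 5 → ℂ} (hz : (fun k => (z k).im) ∈ ksPosCone) (u : Fin k → (Fin 8 ⊕ Fin 8 → ℝ)) :
    ∑ m, c (Function.update u m
      (Sum.elim (-(ksMatrix (fun k => (z k).im) *ᵥ fun j => u m (Sum.inr j)))
        ((ksMatrix (fun k => (z k).im))⁻¹ *ᵥ fun i => u m (Sum.inl i)))) = 0 := by
  obtain ⟨uu, huu⟩ := tkc_ksMatrix_inv_mem_span (fun k => (z k).im) hz
  have hsplit : ∀ w : (Fin 8 ⊕ Fin 8 → ℝ), (Sum.elim (-(ksMatrix (fun k => (z k).im) *ᵥ fun j => w (Sum.inr j)))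
      ((ksMatrix (fun k => (z k).im))⁻¹ *ᵥ fun i => w (Sum.inl i)) : (Fin 8 ⊕ Fin 8 → ℝ)) =
      -(Sum.elim (ksMatrix (fun k => (z k).im) *ᵥ fun j => w (Sum.inr j)) 0 : (Fin 8 ⊕ Fin 8 → ℝ)) +
        (Sum.elim 0 ((ksMatrix (fun k => (z k).im))⁻¹ *ᵥ fun i => w (Sum.inl i)) : (Fin 8 ⊕ Fin 8 → ℝ)) := by
    intro w
    funext s
    rcases s with i | i <;> simp
  simp only [hsplit]
  have hadd := tkc_deriv_add c
    (fun w : (Fin 8 ⊕ Fin 8 → ℝ) => -(Sum.elim (ksMatrix (fun k => (z k).im) *ᵥ fun j => w (Sum.inr j)) 0 : (Fin 8 ⊕ Fin 8 → ℝ)))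
    (fun w : (Fin 8 ⊕ Fin 8 → ℝ) => (Sum.elim 0 ((ksMatrix (fun k => (z k).im))⁻¹ *ᵥ fun i => w (Sum.inl i)) : (Fin 8 ⊕ Fin 8 → ℝ))) u
  have hneg := tkc_deriv_neg c
    (fun w : (Fin 8 ⊕ Fin 8 → ℝ) => (Sum.elim (ksMatrix (fun k => (z k).im) *ᵥ fun j => w (Sum.inr j)) 0 : (Fin 8 ⊕ Fin 8 → ℝ))) u
  rw [hadd, hneg, tkc_deriv_NR_zero c hN (fun k => (z k).im) u, neg_zero, zero_add, huu]
  exact tkc_deriv_N'_zero c hN' uu u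

/-- **THE FLATNESS CRITERION.** A constant alternating `k`-form on `Λ_ℝ = ℝ⁸ ⊕ ℝ⁸` (`k = 2p`) which
is killed by the ten cusp derivations — the raising operators `Nᵢ(x, y) = (Bᵢ y, 0)` and the lowering
operators `N'ⱼ(x, y) = (0, Cⱼ x)`, `Cⱼ = B₁⁻¹ Bⱼ B₁⁻¹`, `i, j < 5` — is of type `(p,p)` on EVERY member
of the Kuga–Satake family: for every `z` with `Im z ∈ ksPosCone` and every Kuga–Satake period map `Φ`
of `z`, `ComplexTorus.IsConstOfType p p (c ∘ Φ⁻¹)`. Proof: `J_z = A_R⁻¹ J_(iS) A_R` (part A2); `c` is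
`A_R`-invariant (unipotent integration of `D_(N_R) c = 0`) and killed by `D_(J_(iS))`
(`tkc_deriv_J0_zero`), hence by `D_(J_z)` (conjugation); integrate along `J_z` (`J_z² = −1`) to the
rotation invariance `c(e^(θJ_z) w) = c(w)`, which is the type-`(p,p)` condition through `Φ`.
[cite: vanGeemenVerra2003QuaternionicPryms, §6.1] [cite: LangeBirkenhake1992, §1.1.5] -/
theorem tkc_isConstOfType_of_cusp_derivations {p : ℕ} (hk : p + p = k) (c : (Fin 8 ⊕ Fin 8 → ℝ) [⋀^Fin k]→L[ℝ] ℂ)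
    (hN : ∀ (i : Fin 5) (w : Fin k → (Fin 8 ⊕ Fin 8 → ℝ)), ∑ m, c (Function.update w m
      (Sum.elim ((ksForm i).map (Int.cast : ℤ → ℝ) *ᵥ fun j => w m (Sum.inr j)) 0)) = 0)
    (hN' : ∀ (j : Fin 5) (w : Fin k → (Fin 8 ⊕ Fin 8 → ℝ)), ∑ m, c (Function.update w m
      (Sum.elim 0 (((Matrix.diagonal fun i : Fin 8 => ((((![2, 4, 4, 8, 4, 8, 8, 16] : Fin 8 → ℤ) i : ℝ))⁻¹)) * (ksForm j).map (Int.cast : ℤ → ℝ) * (Matrix.diagonal fun i : Fin 8 => ((((![2, 4, 4, 8, 4, 8, 8, 16] : Fin 8 → ℤ) i : ℝ))⁻¹))) *ᵥ fun i => w m (Sum.inl i)))) = 0)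
    {z : Fin 5 → ℂ} (hz : (fun k => (z k).im) ∈ ksPosCone)
    {Φ : (Fin 8 ⊕ Fin 8 → ℝ) ≃L[ℝ] (Fin 8 → ℂ)} (hΦ : IsKSPeriodMap z Φ) :
    ComplexTorus.IsConstOfType p p
      (c.compContinuousLinearMap (Φ.symm : (Fin 8 → ℂ) →L[ℝ] (Fin 8 ⊕ Fin 8 → ℝ))) := by
  refine ⟨hk, fun θ v => ?_⟩
  -- the complex structure `J = Φ⁻¹ ∘ i ∘ Φ` as a real continuous linear map
  let Jc : (Fin 8 ⊕ Fin 8 → ℝ) →L[ℝ] (Fin 8 ⊕ Fin 8 → ℝ) :=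
    ((Φ.symm : (Fin 8 → ℂ) →L[ℝ] (Fin 8 ⊕ Fin 8 → ℝ)).comp
      (((Complex.I • ContinuousLinearMap.id ℂ (Fin 8 → ℂ)).restrictScalars ℝ).comp
        (Φ : (Fin 8 ⊕ Fin 8 → ℝ) →L[ℝ] (Fin 8 → ℂ))))
  have hJc : ∀ w, Jc w = Φ.symm (Complex.I • Φ w) := fun w => rfl
  have hJ2 : ∀ w, Jc (Jc w) = -w := by
    intro w
    rw [hJc, hJc, ContinuousLinearEquiv.apply_symm_apply, smul_smul, Complex.I_mul_I, neg_one_smul,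
      map_neg, ContinuousLinearEquiv.symm_apply_apply]
  -- the unipotent `A_R`, its inverse, and the cusp structure `J_(iS)`
  have hAinv : ∀ w : (Fin 8 ⊕ Fin 8 → ℝ),
      (Sum.elim ((fun i => (Sum.elim ((fun i => w (Sum.inl i)) - ksMatrix (fun k => (z k).re) *ᵥ fun j => w (Sum.inr j))
          (fun j => w (Sum.inr j)) : (Fin 8 ⊕ Fin 8 → ℝ)) (Sum.inl i)) +
          ksMatrix (fun k => (z k).re) *ᵥ fun j => (Sum.elim ((fun i => w (Sum.inl i)) - ksMatrix (fun k => (z k).re) *ᵥ fun j => w (Sum.inr j))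
          (fun j => w (Sum.inr j)) : (Fin 8 ⊕ Fin 8 → ℝ)) (Sum.inr j))
        (fun j => (Sum.elim ((fun i => w (Sum.inl i)) - ksMatrix (fun k => (z k).re) *ᵥ fun j => w (Sum.inr j))
          (fun j => w (Sum.inr j)) : (Fin 8 ⊕ Fin 8 → ℝ)) (Sum.inr j)) : (Fin 8 ⊕ Fin 8 → ℝ)) = w := by
    intro w
    funext s
    rcases s with i | i <;> simp
  have hDJ : ∀ u : Fin k → (Fin 8 ⊕ Fin 8 → ℝ), ∑ m, c (Function.update u m (Jc (u m))) = 0 := by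
    intro u
    have hconj := tkc_deriv_conj c
      (fun w : (Fin 8 ⊕ Fin 8 → ℝ) => (Sum.elim ((fun i => w (Sum.inl i)) + ksMatrix (fun k => (z k).re) *ᵥ fun j => w (Sum.inr j))
        (fun j => w (Sum.inr j)) : (Fin 8 ⊕ Fin 8 → ℝ)))
      (fun w : (Fin 8 ⊕ Fin 8 → ℝ) => (Sum.elim ((fun i => w (Sum.inl i)) - ksMatrix (fun k => (z k).re) *ᵥ fun j => w (Sum.inr j))
        (fun j => w (Sum.inr j)) : (Fin 8 ⊕ Fin 8 → ℝ)))
      (fun w : (Fin 8 ⊕ Fin 8 → ℝ) => (Sum.elim (-(ksMatrix (fun k => (z k).im) *ᵥ fun j => w (Sum.inr j)))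
        ((ksMatrix (fun k => (z k).im))⁻¹ *ᵥ fun i => w (Sum.inl i)) : (Fin 8 ⊕ Fin 8 → ℝ)))
      (tkc_AR_invariant c hN (fun k => (z k).re)) hAinv u
    have h0 := tkc_deriv_J0_zero c hN hN' hz
      (fun m => (Sum.elim ((fun i => u m (Sum.inl i)) + ksMatrix (fun k => (z k).re) *ᵥ fun j => u m (Sum.inr j))
        (fun j => u m (Sum.inr j)) : (Fin 8 ⊕ Fin 8 → ℝ)))
    simp only [Sum.elim_inl, Sum.elim_inr] at hconj h0
    rw [h0] at hconj
    rw [← hconj]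
    refine Finset.sum_congr rfl fun m _ => ?_
    congr 2
    rw [hJc, tkc_J_apply hΦ hz]
  -- integrate along `J`
  have hrot := tkc_rotation_of_deriv_zero c Jc hJ2 hDJ θ (fun m => Φ.symm (v m))
  have hv : ∀ m, Φ.symm (Complex.exp (θ * Complex.I) • v m) =
      Real.cos θ • Φ.symm (v m) + Real.sin θ • Jc (Φ.symm (v m)) := by
    intro m
    have h := tkc_symm_exp_smul_eq Φ θ (Φ.symm (v m))
    rw [ContinuousLinearEquiv.apply_symm_apply] at h
    rw [hJc, ContinuousLinearEquiv.apply_symm_apply]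
    exact h
  simp only [ContinuousAlternatingMap.compContinuousLinearMap_apply, Function.comp_def,
    ContinuousLinearEquiv.coe_coe, hv, hrot, sub_self, Int.cast_zero, zero_mul, Complex.exp_zero, one_mul]

end Main

end Summit.HodgeConjecture.HodgeConjecture.Theorems

end
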